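import Summits.QuantumFields.YangMills.Theorems.BalabanLadderIRcofSchurFejerLaplace
import HarnessLib

/-!
# Schur–Fejér splitting — §5c: the abstract SPLIT WINDOW, `w = E_β · W` (clauses 1–6), the exact mass identity

Ideator `ym-ir-idea-22` g4 · crux `IRcof` (stmt-QuantumFields-26930) · row 47 stub S2ᵛ; source `Cruxes/IRcof/Lines/equipartition_seam_SchurFejerCore.lean`
rev 7 ∕ 8 §5 (5a, 5c; §5 of rev 8 byte-identical to rev 7 per the author), extracted VERBATIM by the custody LEAD ym-ir-line-ab-p1 g7 (LEAD LANE PROTOCOL (b);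
critic ym-ir-crit-3 g4 «rev-7 WORD = GO» 21:54:04Z, K1″–K4″) as the first of two files under the 400-line cap (`…SchurFejerSplitVanishing.lean` is the sequel).

CONTENT.  A SPLIT WINDOW for a subgroup `Γ` (`IsSplitWindow Γ W`: continuous, `0 ≤ W ≤ 1`, symmetric, central, positive type, `W 1 = 1`, exact `Γ`-average);
`isSplitWindow_window` (§3 packaged: the Schur–Fejér window of a cyclic-scalar datum is a split window); `splitWOf π r W β = E_β · W`
(`splitW_eq_splitWOf`); `IsSplitWindow.isPosDefKernel`, `splitWOf_posType` (clause 5), `splitWOf_exact` (clause 6), `twistSplitWeight_of_window`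
(clauses 1–6 ⇒ `TwistSplitWeight` modulo its noise clause), `integral_blind_eq_card_mul_integral_splitWOf` (5c, abstract: `∫ E_β = |ker π| · ∫ E_β · W`);
`mem_ker_of_isMax_reTrace`, `reTrace_lt_of_ne_one` (the maximum set of `h ↦ Re tr r(π h)` is `ker π`).  (5a) — a unitary matrix with `Re tr U = N` is `1` —
rides here as PRIVATE verbatim copies: the gate's `dedup.landed` forbids public restatements of `Literature.Barriers.QuantumFields.{re_trace_le_of_mem_unitaryGroup,
eq_one_of_re_trace_eq}` and the critic's K2″ forbids importing a Barriers file into this cone.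
Same namespace `…EquipartitionSeam.SchurFejer` (K3″); definition lane (`IsSplitWindow`, `splitWOf`).  HONEST: finite-dimensional kernel algebra for one stub of one
registered line (row 47, mechanism 0); width 0; YM mass gap (Clay) NOT proved; `IRcof` 0∕1; R4 = `BalabanLadder.UV` only.
-/

set_option autoImplicit false

noncomputable section

open Finset Complex

namespace Summit.QuantumFields.YangMills.Cruxes.IRcof.EquipartitionSeam.SchurFejer

section Laplace

open MeasureTheory Filter Topology
open Literature.MathematicalPhysics.QuantumFieldTheory Literature.MathematicalPhysics.QuantumLattice
open Summit.QuantumFields.YangMills.Theorems.NonSimplyConnectedLatticeGap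
open Literature.RepresentationTheory.CompactGroups (re_sum_conj_mul_nonneg_of_real sum_mul_mul_nonneg_of_complex)
open Literature.Analysis.Matrix (IsPosDefKernel)

/-- `Re tr U ≤ N` for a unitary `N × N` matrix. [folklore] -/
private theorem re_trace_le_of_mem_unitaryGroup {N : ℕ} {U : Matrix (Fin N) (Fin N) ℂ}
    (hU : U ∈ Matrix.unitaryGroup (Fin N) ℂ) : U.trace.re ≤ N := by
  have hnorm : ∀ a b, ‖U a b‖ ≤ 1 := entry_norm_bound_of_unitary hU
  calc U.trace.re = ∑ a, (U a a).re := by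
        rw [Matrix.trace]
        simp only [Matrix.diag_apply, Complex.re_sum]
    _ ≤ ∑ _a : Fin N, (1 : ℝ) :=
        Finset.sum_le_sum fun a _ => (Complex.re_le_norm _).trans (hnorm a a)
    _ = N := by simp

/-- A unitary `N × N` matrix with `Re tr U = N` is the identity. [folklore] -/
private theorem eq_one_of_mem_unitaryGroup_of_re_trace_eq {N : ℕ} {U : Matrix (Fin N) (Fin N) ℂ}
    (hU : U ∈ Matrix.unitaryGroup (Fin N) ℂ) (htr : U.trace.re = N) : U = 1 := by
  have hnorm : ∀ a b, ‖U a b‖ ≤ 1 := entry_norm_bound_of_unitary hU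
  have hrow : ∀ a, ∑ b, Complex.normSq (U a b) = 1 := by
    intro a
    have h1 : U * star U = 1 := Matrix.mem_unitaryGroup_iff.1 hU
    have h2 := congrFun (congrFun h1 a) a
    rw [Matrix.mul_apply, Matrix.one_apply_eq] at h2
    have h3 : ((∑ b, Complex.normSq (U a b) : ℝ) : ℂ) = 1 := by
      rw [← h2, Complex.ofReal_sum]
      refine Finset.sum_congr rfl fun b _ => ?_
      rw [Matrix.star_apply, Complex.star_def, Complex.mul_conj]
    exact_mod_cast h3
  have hre_le : ∀ a, (U a a).re ≤ 1 := fun a => (Complex.re_le_norm _).trans (hnorm a a)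
  have hsum : ∑ a, (1 - (U a a).re) = 0 := by
    have htr' : U.trace.re = ∑ a, (U a a).re := by
      rw [Matrix.trace]
      simp only [Matrix.diag_apply, Complex.re_sum]
    rw [Finset.sum_sub_distrib, Finset.sum_const, Finset.card_univ, Fintype.card_fin, nsmul_eq_mul,
      mul_one, ← htr', htr, sub_self]
  have hre : ∀ a, (U a a).re = 1 := by
    intro a
    have h0 := (Finset.sum_eq_zero_iff_of_nonneg (fun b _ => sub_nonneg.2 (hre_le b))).1 hsum a
      (Finset.mem_univ a)
    linarith
  have hdiag : ∀ a, U a a = 1 := by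
    intro a
    have hsq : Complex.normSq (U a a) ≤ 1 := by
      rw [Complex.normSq_eq_norm_sq]
      have h := hnorm a a
      nlinarith [norm_nonneg (U a a)]
    rw [Complex.normSq_apply, hre a] at hsq
    have him : (U a a).im = 0 := by nlinarith [sq_nonneg (U a a).im]
    exact Complex.ext (by rw [hre a, Complex.one_re]) (by rw [him, Complex.one_im])
  have hoff : ∀ a b, a ≠ b → U a b = 0 := by
    intro a b hab
    have h1 := hrow a
    rw [← Finset.add_sum_erase _ _ (Finset.mem_univ a), hdiag a, Complex.normSq_one,
      add_eq_left] at h1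
    have h0 := (Finset.sum_eq_zero_iff_of_nonneg (fun c _ => Complex.normSq_nonneg (U a c))).1
      h1 b (Finset.mem_erase.2 ⟨fun h => hab h.symm, Finset.mem_univ b⟩)
    exact Complex.normSq_eq_zero.1 h0
  ext a b
  by_cases hab : a = b
  · subst hab
    rw [hdiag, Matrix.one_apply_eq]
  · rw [hoff a b hab, Matrix.one_apply_ne hab]


variable {G H : Type} [Group G] [TopologicalSpace G] [Group H] [TopologicalSpace H]

omit [TopologicalSpace H] in
/-- The maximum set of `h ↦ Re tr r(π h)` is `ker π` (`r` faithful unitary). -/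
theorem mem_ker_of_isMax_reTrace (π : H →* G) (r : LatticeRep G) {x : H}
    (hx : ∀ y : H, (r.ρ (π y)).trace.re ≤ (r.ρ (π x)).trace.re) : x ∈ π.ker := by
  have h1 : (r.ρ (π 1)).trace.re = r.N := by rw [map_one, reTrace_one]
  have hle : (r.ρ (π x)).trace.re ≤ r.N := re_trace_le_of_mem_unitaryGroup (r.mem_unitary _)
  have heq : (r.ρ (π x)).trace.re = r.N := le_antisymm hle (h1 ▸ hx 1)
  have hone : r.ρ (π x) = 1 := eq_one_of_mem_unitaryGroup_of_re_trace_eq (r.mem_unitary _) heq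
  rw [MonoidHom.mem_ker]
  exact r.injective (by rw [hone, map_one])

/-- For `k ≠ 1`, `Re tr ρH k < dim` (`ρH` faithful unitary). -/
theorem reTrace_lt_of_ne_one (ρH : LatticeRep H) {k : H} (hk : k ≠ 1) :
    (ρH.ρ k).trace.re < ρH.N := by
  refine lt_of_le_of_ne (re_trace_le_of_mem_unitaryGroup (ρH.mem_unitary k)) fun h => hk ?_
  exact ρH.injective (by rw [eq_one_of_mem_unitaryGroup_of_re_trace_eq (ρH.mem_unitary k) h, map_one])


/-! #### §5c The abstract SPLIT WINDOW and S2ᵛ from any split window (the window's representation decoupled from `ρH`)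

A SPLIT WINDOW for a subgroup `Γ` (the kernel of the cover map) is a continuous `W : H → ℝ`, `0 ≤ W ≤ 1`, symmetric,
central, of positive type, with `W 1 = 1` and EXACT `Γ`-average `Σ_{k ∈ Γ} W (k h) = 1`.  §3 says `window ρW N` is one
when `Γ = ⟨k₀⟩` is cyclic of order `N` and `ρW k₀ = ω • 1` (`isSplitWindow_window`).  Everything in §4–§5 only ever used
these eight properties, so S2ᵛ at `(π, ρH, r)` follows from ANY split window for `ker π` — for EVERY faithful `ρH`
(the cell representation) — `splitVanishingAt_of_window`; the window need not be built from `ρH`. -/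

/-- A **split window** for the subgroup `Γ`: the eight properties of `W` that §4–§5 use. -/
structure IsSplitWindow (Γ : Subgroup H) (W : H → ℝ) : Prop where
  continuous : Continuous W
  nonneg : ∀ h, 0 ≤ W h
  le_one : ∀ h, W h ≤ 1
  inv : ∀ h, W h⁻¹ = W h
  conj : ∀ g h, W (g * h * g⁻¹) = W h
  posType : ∀ (n : ℕ) (x : Fin n → H) (v : Fin n → ℂ),
    0 ≤ (∑ i, ∑ j, (starRingEnd ℂ) (v i) * v j * ((W ((x i)⁻¹ * x j) : ℝ) : ℂ)).re
  one : W 1 = 1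
  exact : ∀ h, ∑ᶠ k ∈ (Γ : Set H), W (k * h) = 1

/-- §3 packaged: at a cyclic-scalar datum the Schur–Fejér window is a split window for `Γ = ⟨k₀⟩`. -/
theorem isSplitWindow_window (ρW : LatticeRep H) (hd : 0 < ρW.N) (Γ : Subgroup H) {k₀ : H}
    (hΓ : Γ = Subgroup.zpowers k₀) {N : ℕ} (hN : orderOf k₀ = N) (hNpos : 0 < N) {ω : ℂ}
    (hω : IsPrimitiveRoot ω N) (hk₀ : ρW.ρ k₀ = ω • (1 : Matrix (Fin ρW.N) (Fin ρW.N) ℂ)) :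
    IsSplitWindow Γ (window ρW N) :=
  ⟨continuous_window ρW N, window_nonneg ρW N, window_le_one ρW N, window_inv ρW N, window_conj ρW N,
    window_posType ρW N, window_one ρW hd hNpos, window_exact ρW Γ hΓ hN hNpos hω hk₀⟩

/-- The splitting weight `w = E_β · W` for an abstract window `W`. -/
def splitWOf (π : H →* G) (r : LatticeRep G) (W : H → ℝ) (β : ℝ) (h : H) : ℝ := blind π r β h * W h

/-- The cyclic-scalar weight `splitW` is `splitWOf` of the Schur–Fejér window. -/
lemma splitW_eq_splitWOf (π : H →* G) (r : LatticeRep G) (ρH : LatticeRep H) (N : ℕ) (β : ℝ) :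
    splitW π r ρH N β = splitWOf π r (window ρH N) β := rfl

/-- A split window is a (real) positive-type kernel. -/
theorem IsSplitWindow.isPosDefKernel {Γ : Subgroup H} {W : H → ℝ} (hW : IsSplitWindow Γ W) :
    IsPosDefKernel fun x y : H => W (x⁻¹ * y) := by
  refine ⟨fun x y => ?_, fun n x c => ?_⟩
  · dsimp only
    rw [show y⁻¹ * x = (x⁻¹ * y)⁻¹ by rw [mul_inv_rev, inv_inv], hW.inv]
  · exact sum_mul_mul_nonneg_of_complex (f := W) hW.posType n x c

/-- Clause 5 for `w = E_β · W`. -/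
theorem splitWOf_posType (π : H →* G) (r : LatticeRep G) {W : H → ℝ} (hW : IsSplitWindow π.ker W)
    {β : ℝ} (hβ : 0 ≤ β) (n : ℕ) (x : Fin n → H) (v : Fin n → ℂ) :
    0 ≤ (∑ i, ∑ j, (starRingEnd ℂ) (v i) * v j * ((splitWOf π r W β ((x i)⁻¹ * x j) : ℝ) : ℂ)).re :=
  re_sum_conj_mul_nonneg_of_real (f := splitWOf π r W β)
    (fun n x c => ((isPosDefKernel_blind π r hβ).mul hW.isPosDefKernel).2 n x c) n x v

/-- Clause 6 for `w = E_β · W`: `Σ_{k ∈ ker π} w(k h) = E_β(h)` EXACTLY. -/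
theorem splitWOf_exact (π : H →* G) (r : LatticeRep G) {W : H → ℝ} (hW : IsSplitWindow π.ker W)
    (β : ℝ) (h : H) :
    ∑ᶠ k ∈ (π.ker : Set H), splitWOf π r W β (k * h) = Real.exp (β * (r.ρ (π h)).trace.re) := by
  have h1 : ∀ k ∈ (π.ker : Set H), splitWOf π r W β (k * h) = blind π r β h * W (k * h) := by
    intro k hk
    unfold splitWOf
    rw [blind_kernel_mul π r β (SetLike.mem_coe.1 hk)]
  rw [finsum_mem_congr rfl h1, ← mul_finsum_mem, hW.exact h, mul_one]
  rfl

/-- Clauses 1–6 for `w = E_β · W` from a split window; `TwistSplitWeight` reduces to its noise clause 7. -/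
theorem twistSplitWeight_of_window [IsTopologicalGroup H] [CompactSpace H] [MeasurableSpace H]
    [BorelSpace H] (π : H →* G) (hπ : Continuous π) {W : H → ℝ} (hW : IsSplitWindow π.ker W)
    (ρH : LatticeRep H) (r : LatticeRep G) {β : ℝ} (hβ : 0 ≤ β) (c : ℝ)
    (hnoise : ∫ h in {h : H | (∀ k' : H, k' ∈ π.ker → k' ≠ 1 →
        (ρH.ρ (k'⁻¹ * h)).trace.re < (ρH.ρ h).trace.re)},
        (Real.exp (β * (r.ρ (π h)).trace.re) - splitWOf π r W β h) ∂(haarProbability H) ≤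
      Real.exp (-(c * β)) * ∫ h, splitWOf π r W β h ∂(haarProbability H)) :
    TwistSplitWeight π ρH r c β (splitWOf π r W β) := by
  unfold TwistSplitWeight
  refine ⟨(continuous_blind π r β hπ).mul hW.continuous,
    fun h => mul_nonneg (blind_pos π r β h).le (hW.nonneg h), fun h => ?_, fun g h => ?_,
    splitWOf_posType π r hW hβ, splitWOf_exact π r hW β, hnoise⟩
  · unfold splitWOf
    rw [blind_inv, hW.inv]
  · unfold splitWOf
    rw [blind_conj, hW.conj]

/-- (5c, abstract) **Exact mass identity** `∫ E_β = |ker π| · ∫ E_β · W` for any split window `W`. -/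
theorem integral_blind_eq_card_mul_integral_splitWOf [IsTopologicalGroup H] [CompactSpace H]
    [MeasurableSpace H] [BorelSpace H] (π : H →* G) (hπ : Continuous π)
    (hfin : (π.ker : Set H).Finite) {W : H → ℝ} (hW : IsSplitWindow π.ker W)
    (r : LatticeRep G) (β : ℝ) :
    ∫ h, blind π r β h ∂(haarProbability H) =
      (hfin.toFinset.card : ℝ) * ∫ h, splitWOf π r W β h ∂(haarProbability H) := by
  haveI : (haarProbability H).IsMulLeftInvariant := by
    unfold haarProbability
    infer_instance
  have hWc := hW.continuous
  have hEc := continuous_blind π r β hπ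
  have hint : ∀ k : H, Integrable (fun h => blind π r β h * W (k * h))
      (haarProbability H) := fun k =>
    (hEc.mul (hWc.comp (continuous_const.mul continuous_id))).integrable_of_hasCompactSupport
      (HasCompactSupport.of_compactSpace _)
  have hex : ∀ h, ∑ k ∈ hfin.toFinset, W (k * h) = 1 := fun h => by
    rw [← finsum_mem_eq_finite_toFinset_sum (fun k => W (k * h)) hfin]
    exact hW.exact h
  have htr : ∀ k ∈ hfin.toFinset, ∫ h, blind π r β h * W (k * h) ∂(haarProbability H) =
      ∫ h, splitWOf π r W β h ∂(haarProbability H) := by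
    intro k hk
    have hk' : k ∈ π.ker := SetLike.mem_coe.1 (hfin.mem_toFinset.1 hk)
    have e : (fun h => blind π r β h * W (k * h)) = fun h => splitWOf π r W β (k * h) :=
      funext fun h => by
        unfold splitWOf
        rw [blind_kernel_mul π r β hk']
    rw [e]
    exact integral_mul_left_eq_self (fun x => splitWOf π r W β x) k
  calc ∫ h, blind π r β h ∂(haarProbability H)
      = ∫ h, ∑ k ∈ hfin.toFinset, blind π r β h * W (k * h) ∂(haarProbability H) := by
        congr 1
        funext h
        rw [← Finset.mul_sum, hex h, mul_one]
    _ = ∑ k ∈ hfin.toFinset, ∫ h, blind π r β h * W (k * h) ∂(haarProbability H) :=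
        integral_finsetSum _ fun k _ => hint k
    _ = ∑ k ∈ hfin.toFinset, ∫ h, splitWOf π r W β h ∂(haarProbability H) :=
        Finset.sum_congr rfl htr
    _ = (hfin.toFinset.card : ℝ) * ∫ h, splitWOf π r W β h ∂(haarProbability H) := by
        rw [Finset.sum_const, nsmul_eq_mul]


end Laplace

end Summit.QuantumFields.YangMills.Cruxes.IRcof.EquipartitionSeam.SchurFejer

end
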